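import Summits.NavierStokesRegularity.NavierStokesRegularity.Theorems.StrainDoorsSegregationRigidityNS
import Summits.NavierStokesRegularity.NavierStokesRegularity.Theorems.StrainDoorsAnalyticFrame
import HarnessLib

/-!
# Strain doors — RIGIDITY OF FAVOURABLE SEGREGATION: §25 made UNCONDITIONAL in the door frame (D11 modulo nothing)

LEAD S-door companion (ns-s30-p1 g5) of nsreg-p1 g34's ROUND-49 text `StrainDoorsSegregationRigidity(NS).lean` (landed by
ns-s29-p2 g5 in two parts) and of the frame plate `StrainDoorsAnalyticFrame.lean`.  ROUND-49 §25
`qDensity_eq_zero_of_D11_hypothesis_of_analytic` carries two EXPLICIT hypotheses on `q(t,·) = ½|ω|² − |S|²`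
(real-analyticity, integrability); in the standing frame of the doors D5–D11 — classical unforced solution on `[0,T)`,
`ν > 0`, Sobolev-bounded on every `[0,T'']`, `T'' < T` — both are theorems (`analyticOnNhd_qDensity_of_frame`,
`integrable_qDensity_of_frame`), so:

* §28  `qDensity_eq_zero_of_D11_hypothesis_of_frame` ★★: the segregation half of D11's hypothesis at a time `0 < t < T`
  plus one charged `δ'`-almost record with level margin force `q(t,·) ≡ 0` and `Δp(t,·) ≡ 0` on `ℝ³`;
  `qDensity_eq_zero_of_magicCone_hypothesis_of_frame` (literal `MagicConeDoor` hypothesis on `[t₀,T)`);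
  `frobeniusNormSq_eq_norm_curl_sq_of_D11_hypothesis_of_frame` (`|∇u|²_F = |ω|²` everywhere at that time).
* §29  THE PRESSURELESS INSTANT under D11: `gradient_pressure_eq_zero_of_D11_hypothesis_of_frame` (`∇p(t,·) ≡ 0`, by
  `∇p(t) ∈ L²` + Liouville) and `momentum_eq_vectorBurgers_of_D11_hypothesis_of_frame`
  (`∂ₜu + (u·∇)u = νΔu` pointwise on `ℝ³` at that instant).

HONEST FRAME: negative knowledge about the strength of a door HYPOTHESIS (D11's antecedent makes the flow exactly
pressureless at every charged positive time); nothing here is a regularity statement or a continuation criterion;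
item 0056 `NoTypeII` / 10661 / NS regularity are NOT proved.  `--supports stmt-NavierStokesRegularity-0056 --as helper`.
-/

noncomputable section

open MeasureTheory Set Function Filter InnerProductSpace Metric
open scoped RealInnerProductSpace Laplacian ContDiff Topology ENNReal NNReal
open Real Literature.Analysis Literature.Analysis.FluidPDE Literature.Analysis.FluidPDE.VorticityDirectionDynamics

set_option linter.dupNamespace false

namespace Summit.NavierStokesRegularity.NavierStokesRegularity.Theorems.StrainDoors

/-! ## §28  D11 modulo nothing: the segregation hypothesis at a charged positive time kills `q = Δp` -/

/-- ★★ D11 MODULO NOTHING (door frame, positive times).  In the door frame — classical unforced solution on `[0,T)`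
with `ν > 0`, Sobolev-bounded on every `[0,T'']`, `T'' < T` — assume the segregation half of D11's hypothesis at a time
`0 < t < T` and a charged `δ'`-almost record point with level margin (`δ' < δ`).  Then `q(t,·) = ½|ω|² − |S|² ≡ 0` on
`ℝ³` and `Δp(t,·) ≡ 0`: both explicit hypotheses of `qDensity_eq_zero_of_D11_hypothesis_of_analytic` (real-analyticity
and integrability of `q(t,·)`) are DISCHARGED by `analyticOnNhd_qDensity_of_frame` and `integrable_qDensity_of_frame`. -/
theorem qDensity_eq_zero_of_D11_hypothesis_of_frame {ν T : ℝ} (hν : 0 < ν)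
    {u : ℝ → (EuclideanSpace ℝ (Fin 3)) → (EuclideanSpace ℝ (Fin 3))} {p : ℝ → (EuclideanSpace ℝ (Fin 3)) → ℝ}
    (hsol : IsClassicalNSSolutionOn (Ico 0 T) ν 0 u p) (hSob : ∀ T'' < T, HasBoundedSobolevNormsOn (Icc 0 T'') u)
    {t : ℝ} (ht : t ∈ Ioo 0 T)
    {δ δ' l₀ r₀ r₁ : ℝ} (hl₀ : 0 < l₀) (hδ'δ : δ' < δ) (hδ1 : δ < 1) (hr₀ : 0 < r₀) (hr₁ : r₀ < r₁)
    (hD11 : ∀ x e, IsStrainAlmostArgmax δ u t x e → l₀ < strainQuad u t x e →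
      ∀ y, 0 ≤ newtonNearHess r₀ r₁ e e (x - y) * (qDensity u t y - qDensity u t x))
    {x₀ e₀ : EuclideanSpace ℝ (Fin 3)} (hx₀ : IsStrainAlmostArgmax δ' u t x₀ e₀)
    (hl : l₀ < (1 - δ) / (1 - δ') * strainQuad u t x₀ e₀) :
    (∀ x, qDensity u t x = 0) ∧ ∀ x, (Δ (p t)) x = 0 :=
  qDensity_eq_zero_of_D11_hypothesis_of_analytic hsol ⟨ht.1.le, ht.2⟩ hl₀ hδ'δ hδ1 hr₀ hr₁ hD11 hx₀ hl
    (analyticOnNhd_qDensity_of_frame hν hsol hSob ht) (integrable_qDensity_of_frame hsol hSob ⟨ht.1.le, ht.2⟩)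

/-- ★★ The same with the LITERAL hypothesis of door D11 `MagicConeDoor` on `[t₀,T)` (segregation ∧ pointwise parity at
every charged `δ`-almost record): at every time `t ∈ [t₀,T)`, `t > 0`, carrying a `δ'`-almost record point with level
margin (`δ' < δ`), the Q-field vanishes identically — `|S(t,·)|² = ½|ω(t,·)|²` on `ℝ³` and `Δp(t,·) ≡ 0`. -/
theorem qDensity_eq_zero_of_magicCone_hypothesis_of_frame {ν T t₀ : ℝ} (hν : 0 < ν)
    {u : ℝ → (EuclideanSpace ℝ (Fin 3)) → (EuclideanSpace ℝ (Fin 3))} {p : ℝ → (EuclideanSpace ℝ (Fin 3)) → ℝ}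
    (hsol : IsClassicalNSSolutionOn (Ico 0 T) ν 0 u p) (hSob : ∀ T'' < T, HasBoundedSobolevNormsOn (Icc 0 T'') u)
    {δ δ' l₀ r₀ r₁ : ℝ} (hl₀ : 0 < l₀) (hδ'δ : δ' < δ) (hδ1 : δ < 1) (hr₀ : 0 < r₀) (hr₁ : r₀ < r₁)
    (hD11 : ∀ t ∈ Ico t₀ T, ∀ (x e : EuclideanSpace ℝ (Fin 3)), IsStrainAlmostArgmax δ u t x e →
      l₀ < strainQuad u t x e →
        (∀ y, 0 ≤ newtonNearHess r₀ r₁ e e (x - y) * (qDensity u t y - qDensity u t x)) ∧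
          ‖curl (u t) x‖ ^ 2 - ⟪curl (u t) x, e⟫ ^ 2 ≤ 4 * strainQuad u t x e ^ 2)
    {t : ℝ} (ht : t ∈ Ico t₀ T) (htpos : 0 < t)
    {x₀ e₀ : EuclideanSpace ℝ (Fin 3)} (hx₀ : IsStrainAlmostArgmax δ' u t x₀ e₀)
    (hl : l₀ < (1 - δ) / (1 - δ') * strainQuad u t x₀ e₀) :
    (∀ x, qDensity u t x = 0) ∧ ∀ x, (Δ (p t)) x = 0 :=
  qDensity_eq_zero_of_D11_hypothesis_of_frame hν hsol hSob ⟨htpos, ht.2⟩ hl₀ hδ'δ hδ1 hr₀ hr₁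
    (fun x e hx hlx => (hD11 t ht x e hx hlx).1) hx₀ hl

/-- ★ COROLLARY (pointwise reading): under the frame version, at such a time the local strain and vorticity magnitudes
are LOCKED everywhere, `|∇u(t,x)|²_F = |ω(t,x)|²` for all `x` (equivalently `|S|² = ½|ω|²`). -/
theorem frobeniusNormSq_eq_norm_curl_sq_of_D11_hypothesis_of_frame {ν T : ℝ} (hν : 0 < ν)
    {u : ℝ → (EuclideanSpace ℝ (Fin 3)) → (EuclideanSpace ℝ (Fin 3))} {p : ℝ → (EuclideanSpace ℝ (Fin 3)) → ℝ}
    (hsol : IsClassicalNSSolutionOn (Ico 0 T) ν 0 u p) (hSob : ∀ T'' < T, HasBoundedSobolevNormsOn (Icc 0 T'') u)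
    {t : ℝ} (ht : t ∈ Ioo 0 T)
    {δ δ' l₀ r₀ r₁ : ℝ} (hl₀ : 0 < l₀) (hδ'δ : δ' < δ) (hδ1 : δ < 1) (hr₀ : 0 < r₀) (hr₁ : r₀ < r₁)
    (hD11 : ∀ x e, IsStrainAlmostArgmax δ u t x e → l₀ < strainQuad u t x e →
      ∀ y, 0 ≤ newtonNearHess r₀ r₁ e e (x - y) * (qDensity u t y - qDensity u t x))
    {x₀ e₀ : EuclideanSpace ℝ (Fin 3)} (hx₀ : IsStrainAlmostArgmax δ' u t x₀ e₀)
    (hl : l₀ < (1 - δ) / (1 - δ') * strainQuad u t x₀ e₀) (x : EuclideanSpace ℝ (Fin 3)) :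
    frobeniusNormSq (fderiv ℝ (u t) x) = ‖curl (u t) x‖ ^ 2 := by
  have h := (qDensity_eq_zero_of_D11_hypothesis_of_frame hν hsol hSob ht hl₀ hδ'δ hδ1 hr₀ hr₁ hD11 hx₀ hl).1 x
  unfold qDensity strainNormSq at h
  linarith


/-! ## §29  … and kills the pressure GRADIENT: the flow is exactly pressureless at that instant -/

/-- ★★ D11 ⇒ PRESSURELESS INSTANT.  In the door frame, the segregation half of D11's hypothesis at a time `0 < t < T`
plus one charged `δ'`-almost record with level margin force `∇p(t,·) ≡ 0` on `ℝ³` (`Δp(t,·) ≡ 0` by §28, `∇p(t) ∈ L²`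
in the frame, Liouville in `L²` for the harmonic components `∂ₐp`). -/
theorem gradient_pressure_eq_zero_of_D11_hypothesis_of_frame {ν T : ℝ} (hν : 0 < ν)
    {u : ℝ → (EuclideanSpace ℝ (Fin 3)) → (EuclideanSpace ℝ (Fin 3))} {p : ℝ → (EuclideanSpace ℝ (Fin 3)) → ℝ}
    (hsol : IsClassicalNSSolutionOn (Ico 0 T) ν 0 u p) (hSob : ∀ T'' < T, HasBoundedSobolevNormsOn (Icc 0 T'') u)
    {t : ℝ} (ht : t ∈ Ioo 0 T)
    {δ δ' l₀ r₀ r₁ : ℝ} (hl₀ : 0 < l₀) (hδ'δ : δ' < δ) (hδ1 : δ < 1) (hr₀ : 0 < r₀) (hr₁ : r₀ < r₁)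
    (hD11 : ∀ x e, IsStrainAlmostArgmax δ u t x e → l₀ < strainQuad u t x e →
      ∀ y, 0 ≤ newtonNearHess r₀ r₁ e e (x - y) * (qDensity u t y - qDensity u t x))
    {x₀ e₀ : EuclideanSpace ℝ (Fin 3)} (hx₀ : IsStrainAlmostArgmax δ' u t x₀ e₀)
    (hl : l₀ < (1 - δ) / (1 - δ') * strainQuad u t x₀ e₀) (x : EuclideanSpace ℝ (Fin 3)) :
    gradient (p t) x = 0 :=
  gradient_pressure_eq_zero_of_laplacian_eq_zero_of_frame hν hsol hSob ⟨ht.1.le, ht.2⟩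
    (qDensity_eq_zero_of_D11_hypothesis_of_frame hν hsol hSob ht hl₀ hδ'δ hδ1 hr₀ hr₁ hD11 hx₀ hl).2 x

/-- ★★ D11 ⇒ VECTOR BURGERS AT THAT INSTANT.  Under the same hypotheses the momentum equation at time `t` reads
`∂ₜu + (u·∇)u = νΔu` pointwise on `ℝ³` (no pressure force anywhere). -/
theorem momentum_eq_vectorBurgers_of_D11_hypothesis_of_frame {ν T : ℝ} (hν : 0 < ν)
    {u : ℝ → (EuclideanSpace ℝ (Fin 3)) → (EuclideanSpace ℝ (Fin 3))} {p : ℝ → (EuclideanSpace ℝ (Fin 3)) → ℝ}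
    (hsol : IsClassicalNSSolutionOn (Ico 0 T) ν 0 u p) (hSob : ∀ T'' < T, HasBoundedSobolevNormsOn (Icc 0 T'') u)
    {t : ℝ} (ht : t ∈ Ioo 0 T)
    {δ δ' l₀ r₀ r₁ : ℝ} (hl₀ : 0 < l₀) (hδ'δ : δ' < δ) (hδ1 : δ < 1) (hr₀ : 0 < r₀) (hr₁ : r₀ < r₁)
    (hD11 : ∀ x e, IsStrainAlmostArgmax δ u t x e → l₀ < strainQuad u t x e →
      ∀ y, 0 ≤ newtonNearHess r₀ r₁ e e (x - y) * (qDensity u t y - qDensity u t x))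
    {x₀ e₀ : EuclideanSpace ℝ (Fin 3)} (hx₀ : IsStrainAlmostArgmax δ' u t x₀ e₀)
    (hl : l₀ < (1 - δ) / (1 - δ') * strainQuad u t x₀ e₀) (x : EuclideanSpace ℝ (Fin 3)) :
    timeDerivWithin (Ico 0 T) u t x + convect (u t) (u t) x = ν • (Δ (u t)) x :=
  momentum_pressureless_of_laplacian_eq_zero_of_frame hν hsol hSob ⟨ht.1.le, ht.2⟩
    (qDensity_eq_zero_of_D11_hypothesis_of_frame hν hsol hSob ht hl₀ hδ'δ hδ1 hr₀ hr₁ hD11 hx₀ hl).2 x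

/-- ★ MEMBER for the literal `MagicConeDoor` hypothesis on `[t₀,T)`: at every time `t ∈ [t₀,T)`, `t > 0`, carrying a
charged `δ'`-almost record with level margin, `∇p(t,·) ≡ 0` and the momentum equation is vector Burgers at `t`. -/
theorem pressureless_of_magicCone_hypothesis_of_frame {ν T t₀ : ℝ} (hν : 0 < ν)
    {u : ℝ → (EuclideanSpace ℝ (Fin 3)) → (EuclideanSpace ℝ (Fin 3))} {p : ℝ → (EuclideanSpace ℝ (Fin 3)) → ℝ}
    (hsol : IsClassicalNSSolutionOn (Ico 0 T) ν 0 u p) (hSob : ∀ T'' < T, HasBoundedSobolevNormsOn (Icc 0 T'') u)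
    {δ δ' l₀ r₀ r₁ : ℝ} (hl₀ : 0 < l₀) (hδ'δ : δ' < δ) (hδ1 : δ < 1) (hr₀ : 0 < r₀) (hr₁ : r₀ < r₁)
    (hD11 : ∀ t ∈ Ico t₀ T, ∀ (x e : EuclideanSpace ℝ (Fin 3)), IsStrainAlmostArgmax δ u t x e →
      l₀ < strainQuad u t x e →
        (∀ y, 0 ≤ newtonNearHess r₀ r₁ e e (x - y) * (qDensity u t y - qDensity u t x)) ∧
          ‖curl (u t) x‖ ^ 2 - ⟪curl (u t) x, e⟫ ^ 2 ≤ 4 * strainQuad u t x e ^ 2)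
    {t : ℝ} (ht : t ∈ Ico t₀ T) (htpos : 0 < t)
    {x₀ e₀ : EuclideanSpace ℝ (Fin 3)} (hx₀ : IsStrainAlmostArgmax δ' u t x₀ e₀)
    (hl : l₀ < (1 - δ) / (1 - δ') * strainQuad u t x₀ e₀) :
    (∀ x, gradient (p t) x = 0) ∧
      ∀ x, timeDerivWithin (Ico 0 T) u t x + convect (u t) (u t) x = ν • (Δ (u t)) x :=
  ⟨gradient_pressure_eq_zero_of_D11_hypothesis_of_frame hν hsol hSob ⟨htpos, ht.2⟩ hl₀ hδ'δ hδ1 hr₀ hr₁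
      (fun x e hx hlx => (hD11 t ht x e hx hlx).1) hx₀ hl,
    momentum_eq_vectorBurgers_of_D11_hypothesis_of_frame hν hsol hSob ⟨htpos, ht.2⟩ hl₀ hδ'δ hδ1 hr₀ hr₁
      (fun x e hx hlx => (hD11 t ht x e hx hlx).1) hx₀ hl⟩

end Summit.NavierStokesRegularity.NavierStokesRegularity.Theorems.StrainDoors

end
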